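import Literature.Probability.MarkovChains.HMCExpDeltaH
import Literature.Probability.MarkovChains.MultipleTimeScaleIntegrator
import HarnessLib

/-!
# The energy-error symmetry of reversible, volume-preserving integrators:
# `∫ φ(Δ) e^{−H} = ∓ ∫ φ(Δ) e^{−H∘Ψ}` (φ odd / even), `2μ = ∫ Δ(1 − e^{−Δ})e^{−H}`, `0 ≤ μ ≤ s²`
# (Beskos–Pillai–Roberts–Sanz-Serna–Stuart 2013, Lemma 3.3)

A. Beskos, N. Pillai, G. Roberts, J. M. Sanz-Serna, A. Stuart, *Optimal tuning of the hybrid Monte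
Carlo algorithm*, Bernoulli 19 (5A) (2013) 1501–1534 [BeskosEtAl2013] = arXiv:1001.4460 (held text
`paper:arxiv-1001.4460`, p0005, p0007, p0015):

> (§2) 3. Time Reversibility: If `𝒮` denotes the symmetry operator `𝒮(Q,P) = (Q,−P)` then
> `ℋ ∘ 𝒮 = ℋ` and `𝒮 ∘ (Φ_t)⁻¹ ∘ 𝒮 = Φ_t`. …
> (§3) `Δ(x,h) = H(ψ_h^{(T)}(x)) − H(x)` … `μ(h) := E[Δ(x,h)] = ∫ Δ(x,h) e^{−H(x)} dx`,
> `s²(h) := E[|Δ(x,h)|²]` …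
> **Lemma 3.3.** Let `ψ_h^{(T)}` be any volume preserving, time reversible numerical integrator …
> If `φ : ℝ → ℝ` is an odd function then `∫ φ(Δ(x,h)) e^{−H(x)} dx = −∫ φ(Δ(x,h)) e^{−H(ψ(x))} dx`
> provided at least one of the integrals above exist. If `φ` is an even function, then
> `∫ φ(Δ(x,h)) e^{−H(x)} dx = ∫ φ(Δ(x,h)) e^{−H(ψ(x))} dx` …
> Applying this lemma with `φ(u) = u`, we obtain `μ(h) = −∫ Δ(x,h) e^{−H(ψ(x))} dx`, which implies
> that `2μ(h) = ∫ Δ(x,h)[1 − exp(−Δ(x,h))] e^{−H(x)} dx`. We now use first the inequality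
> `|e^u − 1| ≤ |u|(e^u + 1)` and then Lemma 3.3 with `φ(u) = u²` to conclude that
> `|2μ(h)| ≤ ∫ |Δ|² e^{−H(ψ(x))} dx + ∫ |Δ|² e^{−H(x)} dx ≤ 2∫ |Δ|² e^{−H(x)} dx = 2s²(h)`.
> The bound … is important: it shows that the average of `Δ(x,h)` is actually of the order of
> (the average of) `Δ(x,h)²`.
> (Proof of Lemma 3.3, §6) The volume preservation property … setting `x = ψ⁻¹(y)` …
> `S ∘ ψ = ψ⁻¹ ∘ S` … the volume preserving transformation `y = Sz` … the identity `H(Sz) = H(z)`.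

Also quoted by Blanes–Casas–Sanz-Serna 2014 §3 [BlanesCasasSanzserna2014]: "`0 ≤ E(Δ) ≤ ∫ Δ² e^{−H}`
… the result holds under the only hypotheses that the transformation `Ψ` is volume-preserving and
reversible."

Sequel to `HMCExpDeltaH.lean` (`⟨e^{−Δ}⟩ = 1`, `⟨Δ⟩ ≥ 0` from volume preservation ALONE; its
`partitionFn`, `boltzmann`, `integral_boltzmann` are REUSED) — here the finer consequences of volume
preservation PLUS time reversibility.  Lean reading: phase space is ANY measurable space `Ω` with
reference measure `vol`; `H : Ω → ℝ` measurable; the integrator `T : Ω → Ω` and the symmetry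
`S : Ω → Ω` preserve `vol`; `S` is an involution with `H ∘ S = H`; time reversibility
`S ∘ T = T⁻¹ ∘ S` is written inverse-free as `T (S (T x)) = S x` (for `S` = momentum flip this is the
tree's `IsReversible T`, `MultipleTimeScaleIntegrator.lean`).  The proof is the source's, packaged
through the volume-preserving involution `R = S ∘ T` (`R (R x) = x`, `H (R x) = H (T x)`,
`Δ (R x) = −Δ x`).

This file PROVES (everything a theorem; no named facts):
* `deltaH_comp_symm`, `hamiltonian_comp_symm` — `Δ(S(Tx)) = −Δ(x)`, `H(S(Tx)) = H(Tx)`;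
* **`integral_comp_deltaH_symm`** — the master identity `∫ e^{−H(x)} φ(Δx) = ∫ e^{−H(Tx)} φ(−Δx)`
  for every measurable `φ` (no integrability needed: both sides are Bochner integrals of a function
  and of its composition with the `vol`-preserving `R`), and the Boltzmann form
  **`integral_symm_exp_neg_deltaH`**: `∫ e^{−H} φ(Δ) = ∫ e^{−H} e^{−Δ} φ(−Δ)`;
* **`integral_odd_deltaH`**, **`integral_even_deltaH`** — Lemma 3.3 as printed;
* `integrable_comp_deltaH_symm_iff` — `e^{−H∘T}φ(−Δ)` is integrable iff `e^{−H}φ(Δ)` is;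
* **`mu_eq_neg_integral`** (`μ = −∫ Δ e^{−H∘T}`), **`two_mu_eq`** (`2μ = ∫ Δ(1 − e^{−Δ}) e^{−H}`);
* `abs_exp_sub_one_le` (`|e^u − 1| ≤ |u|(e^u + 1)`), **`abs_mu_le_sq`** (`|μ| ≤ s²`),
  **`mu_nonneg`** (`0 ≤ μ`, from `u(1 − e^{−u}) ≥ 0`), and the normalised (Boltzmann-law) versions
  **`integral_deltaH_boltzmann_le_sq`** (`0 ≤ ⟨Δ⟩ ≤ ⟨Δ²⟩`);
* the flat phase-space instance for the tree's integrators: **`IsReversible.integral_deltaH_le_sq`**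
  (any `IsReversible`, volume-preserving `T` on `(ι → ℝ) × (ι → ℝ)`, any measurable `H` even in the
  momenta), e.g. leapfrog / nested / Sexton–Weingarten trajectories.

Scope (honest): exactly the printed hypotheses (volume preservation, time reversibility, `H ∘ S = H`);
the `h`-expansions (Conditions 3.1–3.2, Proposition 3.4: `μ(h) ∼ h⁴`), the `d → ∞` scaling limit and
the optimal acceptance `0.651` (Theorems 3.6, 4.x) are NOT formalised.

## References
* [BeskosEtAl2013] A. Beskos, N. Pillai, G. Roberts, J. M. Sanz-Serna, A. Stuart, Optimal tuning of
  the hybrid Monte Carlo algorithm, Bernoulli 19 (5A) (2013) 1501–1534, doi:10.3150/12-BEJ414,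
  arXiv:1001.4460 — §2 (time reversibility), §3 Lemma 3.3 and the two displays following it
  (`μ(h) = −∫Δe^{−H∘ψ}`, `2μ(h) = ∫Δ(1 − e^{−Δ})e^{−H}`, `|2μ(h)| ≤ 2s²(h)`), §6 proof of Lemma 3.3.
* [BlanesCasasSanzserna2014] S. Blanes, F. Casas, J. M. Sanz-Serna, SIAM J. Sci. Comput. 36 (2014),
  §3 (the display `0 ≤ E(Δ) ≤ ∫Δ²e^{−H}`).
* [MontvayMunster1994] I. Montvay, G. Münster, Quantum Fields on a Lattice, §7.6.1 (7.223), (7.233)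
  (reversibility and area preservation of leapfrog; parent files).
-/

noncomputable section

open MeasureTheory Real

namespace Literature.Probability.MarkovChains.HMC

variable {Ω : Type*} [MeasurableSpace Ω] {vol : Measure Ω} {H : Ω → ℝ} {T S : Ω → Ω}

/-! ### §1 The volume-preserving involution `R = S ∘ T` -/

omit [MeasurableSpace Ω] in
/-- Time reversibility `S ∘ ψ = ψ⁻¹ ∘ S` in inverse-free form, `ψ(S(ψ x)) = S x`, gives
`H(S(ψ x)) = H(ψ x)` when `H ∘ S = H`. [cite: BeskosEtAl2013, §2 (time reversibility, ℋ ∘ 𝒮 = ℋ)] -/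
theorem hamiltonian_comp_symm (hHS : ∀ x, H (S x) = H x) (x : Ω) : H (S (T x)) = H (T x) :=
  hHS (T x)

omit [MeasurableSpace Ω] in
/-- `Δ(S(ψ x)) = −Δ(x)`: the energy error is odd under `R = S ∘ ψ`.
[cite: BeskosEtAl2013, §6 proof of Lemma 3.3 (last two displays)] -/
theorem deltaH_comp_symm (hHS : ∀ x, H (S x) = H x) (hrev : ∀ x, T (S (T x)) = S x) (x : Ω) :
    H (T (S (T x))) - H (S (T x)) = -(H (T x) - H x) := by
  rw [hrev, hHS, hHS]
  ring

omit [MeasurableSpace Ω] in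
/-- `R = S ∘ ψ` is an involution. [cite: BeskosEtAl2013, §2 (𝒮 ∘ Φ_t⁻¹ ∘ 𝒮 = Φ_t)] -/
theorem symm_comp_involutive (hSS : ∀ x, S (S x) = x) (hrev : ∀ x, T (S (T x)) = S x) (x : Ω) :
    S (T (S (T x))) = x := by
  rw [hrev, hSS]

/-! ### §2 Lemma 3.3 -/

/-- **The master identity** behind Lemma 3.3: for volume-preserving `ψ` and `S`, `S` with
`H ∘ S = H`, and time reversibility `ψ ∘ S ∘ ψ = S`, for EVERY measurable `φ`:
`∫ e^{−H(x)} φ(Δ(x)) dx = ∫ e^{−H(ψ x)} φ(−Δ(x)) dx` (change of variables `x ↦ S(ψ x)`).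
[cite: BeskosEtAl2013, §3 Lemma 3.3 and §6 (its proof)] -/
theorem integral_comp_deltaH_symm (hT : MeasurePreserving T vol vol) (hS : MeasurePreserving S vol vol)
    (hHS : ∀ x, H (S x) = H x) (hrev : ∀ x, T (S (T x)) = S x) (hH : Measurable H)
    {φ : ℝ → ℝ} (hφ : Measurable φ) :
    ∫ x, exp (-H x) * φ (H (T x) - H x) ∂vol = ∫ x, exp (-H (T x)) * φ (-(H (T x) - H x)) ∂vol := by
  have hR : MeasurePreserving (S ∘ T) vol vol := hS.comp hT
  have hg : Measurable fun x => exp (-H x) * φ (H (T x) - H x) :=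
    (hH.neg.exp).mul (hφ.comp ((hH.comp hT.measurable).sub hH))
  have hg' : AEStronglyMeasurable (fun x => exp (-H x) * φ (H (T x) - H x)) (Measure.map (S ∘ T) vol) := by
    rw [hR.map_eq]
    exact hg.aestronglyMeasurable
  have key := integral_map hR.measurable.aemeasurable hg'
  rw [hR.map_eq] at key
  rw [key]
  refine integral_congr_ae (Filter.Eventually.of_forall fun x => ?_)
  simp only [Function.comp_apply]
  rw [deltaH_comp_symm hHS hrev, hHS]

/-- The same identity in Boltzmann form: `∫ e^{−H} φ(Δ) = ∫ e^{−H} e^{−Δ} φ(−Δ)` — with `φ ≡ 1` this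
is `⟨e^{−Δ}⟩ = 1` (parent file, which needs volume preservation only).
[cite: BeskosEtAl2013, §3 Lemma 3.3] -/
theorem integral_symm_exp_neg_deltaH (hT : MeasurePreserving T vol vol)
    (hS : MeasurePreserving S vol vol) (hHS : ∀ x, H (S x) = H x) (hrev : ∀ x, T (S (T x)) = S x)
    (hH : Measurable H) {φ : ℝ → ℝ} (hφ : Measurable φ) :
    ∫ x, exp (-H x) * φ (H (T x) - H x) ∂vol =
      ∫ x, exp (-H x) * (exp (-(H (T x) - H x)) * φ (-(H (T x) - H x))) ∂vol := by
  rw [integral_comp_deltaH_symm hT hS hHS hrev hH hφ]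
  refine integral_congr_ae (Filter.Eventually.of_forall fun x => ?_)
  simp only
  rw [← mul_assoc, ← Real.exp_add]
  congr 2
  ring

/-- **Lemma 3.3, odd `φ`**: `∫ φ(Δ) e^{−H} = −∫ φ(Δ) e^{−H∘ψ}`. [cite: BeskosEtAl2013, §3 Lemma 3.3
(first assertion)] -/
theorem integral_odd_deltaH (hT : MeasurePreserving T vol vol) (hS : MeasurePreserving S vol vol)
    (hHS : ∀ x, H (S x) = H x) (hrev : ∀ x, T (S (T x)) = S x) (hH : Measurable H)
    {φ : ℝ → ℝ} (hφ : Measurable φ) (hodd : ∀ u, φ (-u) = -φ u) :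
    ∫ x, exp (-H x) * φ (H (T x) - H x) ∂vol = -∫ x, exp (-H (T x)) * φ (H (T x) - H x) ∂vol := by
  rw [integral_comp_deltaH_symm hT hS hHS hrev hH hφ, ← integral_neg]
  refine integral_congr_ae (Filter.Eventually.of_forall fun x => ?_)
  simp only [hodd, mul_neg]

/-- **Lemma 3.3, even `φ`**: `∫ φ(Δ) e^{−H} = ∫ φ(Δ) e^{−H∘ψ}`. [cite: BeskosEtAl2013, §3 Lemma 3.3
(second assertion)] -/
theorem integral_even_deltaH (hT : MeasurePreserving T vol vol) (hS : MeasurePreserving S vol vol)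
    (hHS : ∀ x, H (S x) = H x) (hrev : ∀ x, T (S (T x)) = S x) (hH : Measurable H)
    {φ : ℝ → ℝ} (hφ : Measurable φ) (heven : ∀ u, φ (-u) = φ u) :
    ∫ x, exp (-H x) * φ (H (T x) - H x) ∂vol = ∫ x, exp (-H (T x)) * φ (H (T x) - H x) ∂vol := by
  rw [integral_comp_deltaH_symm hT hS hHS hrev hH hφ]
  refine integral_congr_ae (Filter.Eventually.of_forall fun x => ?_)
  simp only [heven]

/-- Integrability transfers along the symmetry: `e^{−H∘ψ} φ(−Δ)` is integrable iff `e^{−H} φ(Δ)` is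
("provided at least one of the integrals above exist"). [cite: BeskosEtAl2013, §3 Lemma 3.3] -/
theorem integrable_comp_deltaH_symm_iff (hT : MeasurePreserving T vol vol)
    (hS : MeasurePreserving S vol vol) (hHS : ∀ x, H (S x) = H x) (hrev : ∀ x, T (S (T x)) = S x)
    (hH : Measurable H) {φ : ℝ → ℝ} (hφ : Measurable φ) :
    Integrable (fun x => exp (-H (T x)) * φ (-(H (T x) - H x))) vol ↔
      Integrable (fun x => exp (-H x) * φ (H (T x) - H x)) vol := by
  have hR : MeasurePreserving (S ∘ T) vol vol := hS.comp hT
  have hg : Measurable fun x => exp (-H x) * φ (H (T x) - H x) :=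
    (hH.neg.exp).mul (hφ.comp ((hH.comp hT.measurable).sub hH))
  have hcomp : (fun x => exp (-H (T x)) * φ (-(H (T x) - H x))) =
      (fun x => exp (-H x) * φ (H (T x) - H x)) ∘ (S ∘ T) := by
    funext x
    simp only [Function.comp_apply]
    rw [deltaH_comp_symm hHS hrev, hHS]
  rw [hcomp]
  have key := integrable_map_measure (μ := vol) (f := S ∘ T) (g := fun x => exp (-H x) * φ (H (T x) - H x))
    (by rw [hR.map_eq]; exact hg.aestronglyMeasurable) hR.measurable.aemeasurable
  rw [hR.map_eq] at key
  exact key.symm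

/-! ### §3 `μ = −∫ Δ e^{−H∘ψ}`, `2μ = ∫ Δ(1 − e^{−Δ}) e^{−H}`, `|μ| ≤ s²`, `μ ≥ 0` -/

/-- **`μ(h) = −∫ Δ(x,h) e^{−H(ψ x)} dx`** (Lemma 3.3 with `φ(u) = u`).
[cite: BeskosEtAl2013, §3, first display after Lemma 3.3] -/
theorem mu_eq_neg_integral (hT : MeasurePreserving T vol vol) (hS : MeasurePreserving S vol vol)
    (hHS : ∀ x, H (S x) = H x) (hrev : ∀ x, T (S (T x)) = S x) (hH : Measurable H) :
    ∫ x, exp (-H x) * (H (T x) - H x) ∂vol = -∫ x, exp (-H (T x)) * (H (T x) - H x) ∂vol :=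
  integral_odd_deltaH hT hS hHS hrev hH measurable_id (fun _ => rfl)

/-- **`2μ(h) = ∫ Δ(x,h)[1 − exp(−Δ(x,h))] e^{−H(x)} dx`**, for `Δ e^{−H}` integrable.
[cite: BeskosEtAl2013, §3, second display after Lemma 3.3] -/
theorem two_mu_eq (hT : MeasurePreserving T vol vol) (hS : MeasurePreserving S vol vol)
    (hHS : ∀ x, H (S x) = H x) (hrev : ∀ x, T (S (T x)) = S x) (hH : Measurable H)
    (hint : Integrable (fun x => exp (-H x) * (H (T x) - H x)) vol) :
    2 * ∫ x, exp (-H x) * (H (T x) - H x) ∂vol =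
      ∫ x, exp (-H x) * ((H (T x) - H x) * (1 - exp (-(H (T x) - H x)))) ∂vol := by
  -- the integrand `e^{−H∘ψ} Δ = e^{−H} e^{−Δ} Δ` is integrable by the symmetry
  have hint2 : Integrable (fun x => exp (-H (T x)) * (H (T x) - H x)) vol := by
    have h0 : Integrable (fun x => exp (-H x) * (-(H (T x) - H x))) vol := by
      refine hint.neg.congr (Filter.Eventually.of_forall fun x => ?_)
      simp only [Pi.neg_apply]
      ring
    have h := (integrable_comp_deltaH_symm_iff hT hS hHS hrev hH measurable_neg).mpr h0
    refine h.congr (Filter.Eventually.of_forall fun x => ?_)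
    simp only [neg_neg]
  have hmu := mu_eq_neg_integral hT hS hHS hrev hH
  have e1 : ∫ x, exp (-H x) * ((H (T x) - H x) * (1 - exp (-(H (T x) - H x)))) ∂vol =
      ∫ x, exp (-H x) * (H (T x) - H x) ∂vol - ∫ x, exp (-H (T x)) * (H (T x) - H x) ∂vol := by
    rw [← integral_sub hint hint2]
    refine integral_congr_ae (Filter.Eventually.of_forall fun x => ?_)
    have : exp (-H (T x)) = exp (-H x) * exp (-(H (T x) - H x)) := by
      rw [← Real.exp_add]
      congr 1
      ring
    dsimp only
    rw [this]
    ring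
  rw [e1, hmu]
  ring

/-- The elementary inequality `|e^u − 1| ≤ |u|(e^u + 1)`. [cite: BeskosEtAl2013, §3 (display
after Lemma 3.3, "We now use first the inequality …")] -/
theorem abs_exp_sub_one_le (u : ℝ) : |exp u - 1| ≤ |u| * (exp u + 1) := by
  have h1 := Real.add_one_le_exp u
  have h2 := Real.add_one_le_exp (-u)
  have hpos := Real.exp_pos u
  rcases le_or_gt 0 u with hu | hu
  · rw [abs_of_nonneg (by linarith), abs_of_nonneg hu]
    -- `e^u − 1 ≤ u e^u` from `e^{−u} ≥ 1 − u`
    have h3 : exp (-u) * exp u = 1 := by rw [← Real.exp_add]; simp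
    nlinarith [mul_le_mul_of_nonneg_right h2 hpos.le]
  · have h4 : exp u < 1 := Real.exp_lt_one_iff.mpr hu
    rw [abs_of_neg (by linarith), abs_of_neg hu]
    nlinarith [mul_pos (neg_pos.mpr hu) hpos]

/-- Pointwise: `|u (1 − e^{−u})| ≤ u² e^{−u} + u²`. [cite: BeskosEtAl2013, §3 (the step
"`|e^u − 1| ≤ |u|(e^u + 1)`")] -/
theorem abs_mul_one_sub_exp_neg_le (u : ℝ) :
    |u * (1 - exp (-u))| ≤ u ^ 2 * exp (-u) + u ^ 2 := by
  have h := abs_exp_sub_one_le (-u)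
  rw [abs_neg] at h
  rw [abs_mul]
  have e : |1 - exp (-u)| = |exp (-u) - 1| := abs_sub_comm _ _
  rw [e]
  calc |u| * |exp (-u) - 1| ≤ |u| * (|u| * (exp (-u) + 1)) :=
        mul_le_mul_of_nonneg_left h (abs_nonneg u)
    _ = u ^ 2 * exp (-u) + u ^ 2 := by rw [← mul_assoc, abs_mul_abs_self]; ring

/-- Pointwise: `u (1 − e^{−u}) ≥ 0`. [cite: BlanesCasasSanzserna2014, §3 ("0 ≤ E(Δ)")] -/
theorem mul_one_sub_exp_neg_nonneg (u : ℝ) : 0 ≤ u * (1 - exp (-u)) := by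
  rcases le_or_gt 0 u with hu | hu
  · exact mul_nonneg hu (by linarith [Real.exp_le_one_iff.mpr (neg_nonpos.mpr hu)])
  · have : 1 ≤ exp (-u) := Real.one_le_exp_iff.mpr (by linarith)
    nlinarith

/-- **`|μ(h)| ≤ s²(h)`**: `|∫ Δ e^{−H}| ≤ ∫ Δ² e^{−H}` for every volume-preserving, time-reversible
`ψ`, whenever `Δe^{−H}` and `Δ²e^{−H}` are integrable ("the average of `Δ` is actually of the order
of the average of `Δ²`"). [cite: BeskosEtAl2013, §3 eq. (mubd) `|2μ(h)| ≤ 2s²(h)`] -/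
theorem abs_mu_le_sq (hT : MeasurePreserving T vol vol) (hS : MeasurePreserving S vol vol)
    (hHS : ∀ x, H (S x) = H x) (hrev : ∀ x, T (S (T x)) = S x) (hH : Measurable H)
    (hint : Integrable (fun x => exp (-H x) * (H (T x) - H x)) vol)
    (hint2 : Integrable (fun x => exp (-H x) * (H (T x) - H x) ^ 2) vol) :
    |∫ x, exp (-H x) * (H (T x) - H x) ∂vol| ≤ ∫ x, exp (-H x) * (H (T x) - H x) ^ 2 ∂vol := by
  have h2mu := two_mu_eq hT hS hHS hrev hH hint
  -- `∫ Δ² e^{−H∘ψ} = ∫ Δ² e^{−H}` (even lemma) and its integrability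
  have hsq_meas : Measurable fun u : ℝ => u ^ 2 := measurable_id.pow_const 2
  have heven := integral_even_deltaH hT hS hHS hrev hH hsq_meas (fun u => by ring)
  have hint3 : Integrable (fun x => exp (-H (T x)) * (H (T x) - H x) ^ 2) vol := by
    have h := (integrable_comp_deltaH_symm_iff hT hS hHS hrev hH hsq_meas).mpr hint2
    refine h.congr (Filter.Eventually.of_forall fun x => ?_)
    dsimp only
    ring
  -- dominate `|e^{−H} Δ(1 − e^{−Δ})|` by `e^{−H∘ψ}Δ² + e^{−H}Δ²`
  have hdom : ∀ x, ‖exp (-H x) * ((H (T x) - H x) * (1 - exp (-(H (T x) - H x))))‖ ≤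
      exp (-H (T x)) * (H (T x) - H x) ^ 2 + exp (-H x) * (H (T x) - H x) ^ 2 := by
    intro x
    rw [Real.norm_eq_abs, abs_mul, abs_of_pos (exp_pos _)]
    have h := abs_mul_one_sub_exp_neg_le (H (T x) - H x)
    have e : exp (-H (T x)) = exp (-H x) * exp (-(H (T x) - H x)) := by
      rw [← Real.exp_add]
      congr 1
      ring
    rw [e]
    calc exp (-H x) * |(H (T x) - H x) * (1 - exp (-(H (T x) - H x)))|
        ≤ exp (-H x) * ((H (T x) - H x) ^ 2 * exp (-(H (T x) - H x)) + (H (T x) - H x) ^ 2) :=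
          mul_le_mul_of_nonneg_left h (exp_pos _).le
      _ = _ := by ring
  have hbound := norm_integral_le_of_norm_le (hint3.add hint2) (Filter.Eventually.of_forall hdom)
  simp only [Pi.add_apply] at hbound
  rw [integral_add hint3 hint2, ← heven, Real.norm_eq_abs, ← h2mu] at hbound
  rw [abs_mul, abs_two] at hbound
  linarith

/-- **`μ(h) ≥ 0`** for volume-preserving, time-reversible `ψ` (from `2μ = ∫ Δ(1 − e^{−Δ})e^{−H}`
with a non-negative integrand; the parent file obtains it from Jensen and volume preservation alone).
[cite: BlanesCasasSanzserna2014, §3 ("0 ≤ E(Δ) ≤ ∫Δ²e^{−H}")], [cite: BeskosEtAl2013, §3] -/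
theorem mu_nonneg (hT : MeasurePreserving T vol vol) (hS : MeasurePreserving S vol vol)
    (hHS : ∀ x, H (S x) = H x) (hrev : ∀ x, T (S (T x)) = S x) (hH : Measurable H)
    (hint : Integrable (fun x => exp (-H x) * (H (T x) - H x)) vol) :
    0 ≤ ∫ x, exp (-H x) * (H (T x) - H x) ∂vol := by
  have h2mu := two_mu_eq hT hS hHS hrev hH hint
  have hnn : 0 ≤ ∫ x, exp (-H x) * ((H (T x) - H x) * (1 - exp (-(H (T x) - H x)))) ∂vol :=
    integral_nonneg fun x => mul_nonneg (exp_pos _).le (mul_one_sub_exp_neg_nonneg _)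
  linarith

/-- **`0 ≤ ⟨Δ⟩ ≤ ⟨Δ²⟩` under the Boltzmann law `e^{−H}vol/Z`** (normalised form).
[cite: BlanesCasasSanzserna2014, §3], [cite: BeskosEtAl2013, §3 eq. (mubd)] -/
theorem integral_deltaH_boltzmann_le_sq (hT : MeasurePreserving T vol vol)
    (hS : MeasurePreserving S vol vol) (hHS : ∀ x, H (S x) = H x) (hrev : ∀ x, T (S (T x)) = S x)
    (hH : Measurable H) (hZ : 0 < partitionFn vol H)
    (hint : Integrable (fun x => exp (-H x) * (H (T x) - H x)) vol)
    (hint2 : Integrable (fun x => exp (-H x) * (H (T x) - H x) ^ 2) vol) :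
    0 ≤ ∫ x, (H (T x) - H x) ∂(boltzmann vol H) ∧
      ∫ x, (H (T x) - H x) ∂(boltzmann vol H) ≤ ∫ x, (H (T x) - H x) ^ 2 ∂(boltzmann vol H) := by
  rw [integral_boltzmann hH hZ, integral_boltzmann hH hZ]
  have hZinv : 0 < (partitionFn vol H)⁻¹ := inv_pos.mpr hZ
  have h1 := mu_nonneg hT hS hHS hrev hH hint
  have h2 := abs_mu_le_sq hT hS hHS hrev hH hint hint2
  have h3 := le_abs_self (∫ x, exp (-H x) * (H (T x) - H x) ∂vol)
  exact ⟨mul_nonneg hZinv.le h1, mul_le_mul_of_nonneg_left (h3.trans h2) hZinv.le⟩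

/-! ### §4 The flat phase-space instance: the tree's reversible integrators -/

section Flat

variable {ι : Type*} [Fintype ι] {Hf : PhaseSpace ι → ℝ} {Tf : PhaseSpace ι → PhaseSpace ι}

/-- **For every `IsReversible`, volume-preserving map `T` of flat phase space** (leapfrog, nested
leapfrog, Sexton–Weingarten trajectories of the parent files) **and every measurable `H` even in the
momenta with `0 < Z`: `0 ≤ ⟨Δ⟩ ≤ ⟨Δ²⟩`** (given the two moments exist).
[cite: BeskosEtAl2013, §3 Lemma 3.3 and eq. (mubd)], [cite: MontvayMunster1994, §7.6.1 (7.223),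
(7.233)] -/
theorem IsReversible.integral_deltaH_le_sq (hrev : IsReversible Tf)
    (hT : MeasurePreserving Tf volume volume) (hH : Measurable Hf)
    (hHS : ∀ x, Hf (momFlip x) = Hf x) (hZ : 0 < partitionFn volume Hf)
    (hint : Integrable (fun x => exp (-Hf x) * (Hf (Tf x) - Hf x)) volume)
    (hint2 : Integrable (fun x => exp (-Hf x) * (Hf (Tf x) - Hf x) ^ 2) volume) :
    0 ≤ ∫ x, (Hf (Tf x) - Hf x) ∂(boltzmann volume Hf) ∧
      ∫ x, (Hf (Tf x) - Hf x) ∂(boltzmann volume Hf) ≤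
        ∫ x, (Hf (Tf x) - Hf x) ^ 2 ∂(boltzmann volume Hf) :=
  integral_deltaH_boltzmann_le_sq hT measurePreserving_momFlip hHS hrev hH hZ hint hint2

end Flat

end Literature.Probability.MarkovChains.HMC

end
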